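import Literature.Barriers.Parity.SiegelZeroDichotomyPairHLSixSlotBox
import Literature.Barriers.Parity.SiegelZeroDichotomyPairHLPsiFourier
import Mathlib.MeasureTheory.Integral.Pi
import HarnessLib

/-!
# Tao–Teräväinen 2022, §8 (`k = 2`): the pointwise sum as a six-fold Fourier integral of an Euler kernel

Topic `Literature/Barriers/Parity`, sub-namespace `TaoTeravainen`; part of step (v) of the proof DAG
of `Literature.Barriers.Parity.TaoTeravainen2021_prop72_81_pair` (T. Tao, J. Teräväinen, *The
Hardy–Littlewood–Chowla conjecture in the presence of a Siegel zero*, J. London Math. Soc. (2) 106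
(2022), arXiv:2109.06291), §8: "Inserting the expansions (8.12), (8.13) back into (8.9), we see that
`Ψ_d(y+h_j) = log^k x ∫∫∫ ∑_{d₀,d₁,d₂: [d₀,d₁,d₂]=d} χ(d₀)μ(d₁)μ(d₂)/(d₀^{(1+it₀)/log x} d₁^{(1+it₁)/log R}
d₂^{(1+it₂)/log R}) F_j(t₀)f(t₁)f(t₂) dt₀dt₁dt₂`. Inserting this back into the left-hand side of (8.8)
… we can thus write that left-hand side as `log^k x ∫_{ℝ^{3k}} ∏_p E_{p,t} ∏_j F_j(t_{0,j}) f(t_{1,j})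
f(t_{2,j}) dt`." Everything here is PROVED, at `k = 2`, in our normalisation (frequencies `τ`,
`d^{s}` with `s = -1/X + 2πiτ` in the `d`-slots and `s = (-1+2πiτ)/log R` in the sieve slots, the
transforms `ĝ_{c_j}` and `f` of `SiegelZeroDichotomyPairHLPsiFourier.lean`), over the finite box
`sixBox P A` of `SiegelZeroDichotomyPairHLSixSlotBox.lean`:

* `boxRanges`, `sixSummandR` and `smoothPointwise_eq_sum_boxRanges` — the pointwise sum `G(y)` of
  `SiegelZeroDichotomyPairHLMainTermReduction.lean` indexed by six-tuples;
* `sum_boxRanges_eq_sum_sixBox` — the passage to the box (terms outside either set vanish: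
  `μ = 0` off squarefrees, `ψ_{≤R} = 0` beyond `R`, `Ψ = 0` beyond `D_max`);
* `slotExpo`, `npow`, `slotTransform`, `sixKernel` (`K(τ) = ∑_{n ∈ box} dens(n) χχμμμμ ∏_k n_k^{s_k(τ_k)}`),
  `sixWeight` (`W(τ) = ĝ_{c₁}ĝ_{c₂} f f f f`) and **`smoothPointwise_eq_integral`** —
  `G(y) = ∫_{ℝ⁶} K(τ) W(τ) dτ` (Fourier inversion in each slot and Fubini).
  [cite: TaoTeravainen2021, §8 (8.12)–(8.13), (8.17)]
-/

noncomputable section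

open Finset Real MeasureTheory Complex
open scoped ArithmeticFunction.Moebius FourierTransform

namespace Literature.Barriers.Parity

namespace TaoTeravainen

variable {q : ℕ}

/-! ### The pointwise sum indexed by six-tuples -/

/-- The ranges of the original sum: `1 ≤ d ≤ D_max` in the `d`-slots, `sieveRange R` in the sieve
slots. [cite: TaoTeravainen2021, §8 (8.8)] -/
def boxRanges (R : ℝ) (Dmax : ℕ) : Finset (Slot → ℕ) :=
  Fintype.piFinset fun k : Slot => if k.2 = 0 then Icc 1 Dmax else sieveRange R

/-- The triple of side `j` of a six-tuple. [folklore] -/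
def slotTriple (n : Slot → ℕ) (j : Fin 2) : ℕ × ℕ × ℕ := (n (j, 0), n (j, 1), n (j, 2))

/-- The real summand of `G(y)` at a six-tuple. [cite: TaoTeravainen2021, §8 (8.8)] -/
def sixSummandR (χ : DirichletCharacter ℂ q) (φ ψ : ℝ → ℝ) (X U₀ R : ℝ) (h₁ h₂ : ℕ) (y : ℝ) (n : Slot → ℕ) : ℝ :=
  smoothCoeff χ ψ R (slotTriple n 0) * smoothCoeff χ ψ R (slotTriple n 1) *
    crtDensity h₁ h₂ (slotLcm n 0) (slotLcm n 1) *
      (psiSharp φ ψ X U₀ ((y + h₁) / n (0, 0)) * psiSharp φ ψ X U₀ ((y + h₂) / n (1, 0)))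

/-- The equivalence between six-tuples and pairs of triples. [folklore] -/
def slotEquiv : (Slot → ℕ) ≃ (ℕ × ℕ × ℕ) × (ℕ × ℕ × ℕ) where
  toFun n := (slotTriple n 0, slotTriple n 1)
  invFun t := fun k => Fin.cases (Fin.cases t.1.1 (fun i => Fin.cases t.1.2.1 (fun _ => t.1.2.2) i) k.2)
    (fun _ => Fin.cases t.2.1 (fun i => Fin.cases t.2.2.1 (fun _ => t.2.2.2) i) k.2) k.1
  left_inv n := by
    funext k
    rcases k with ⟨j, i⟩
    fin_cases j <;> fin_cases i <;> rfl
  right_inv t := by rfl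

/-- **`G(y)` as a sum over six-tuples.** [cite: TaoTeravainen2021, §8 (8.8)] -/
theorem smoothPointwise_eq_sum_boxRanges (χ : DirichletCharacter ℂ q) (φ ψ : ℝ → ℝ) (X U₀ R : ℝ)
    (h₁ h₂ Dmax : ℕ) (y : ℝ) :
    smoothPointwise χ φ ψ X U₀ R h₁ h₂ Dmax y =
      ∑ n ∈ boxRanges R Dmax, sixSummandR χ φ ψ X U₀ R h₁ h₂ y n := by
  unfold smoothPointwise
  rw [← sum_product']
  symm
  refine sum_equiv slotEquiv (fun n => ?_) (fun n _ => ?_)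
  · -- membership
    unfold boxRanges sharpTriples
    rw [Fintype.mem_piFinset, mem_product, mem_product, mem_product, mem_product, mem_product]
    simp only [slotEquiv, Equiv.coe_fn_mk, slotTriple]
    constructor
    · intro h
      have h00 := h (0, 0); have h01 := h (0, 1); have h02 := h (0, 2)
      have h10 := h (1, 0); have h11 := h (1, 1); have h12 := h (1, 2)
      simp only [Fin.isValue, if_true, show ((1 : Fin 3) = 0) = False by decide,
        show ((2 : Fin 3) = 0) = False by decide, if_false] at h00 h01 h02 h10 h11 h12
      exact ⟨⟨h00, h01, h02⟩, h10, h11, h12⟩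
    · rintro ⟨⟨h00, h01, h02⟩, h10, h11, h12⟩ ⟨j, i⟩
      fin_cases j <;> fin_cases i <;> simp [h00, h01, h02, h10, h11, h12]
  · simp only [slotEquiv, Equiv.coe_fn_mk, sixSummandR, slotTriple, slotLcm_eq_tripleLcm]

/-! ### Passage to the box -/

/-- If `2^(A+1) > d > 0` then every prime valuation of `d` is `≤ A`. [folklore] -/
theorem factorization_le_of_lt_two_pow {A d p : ℕ} (hd : d ≠ 0) (hdA : d < 2 ^ (A + 1)) (hp : p.Prime) :
    d.factorization p ≤ A := by
  have h1 : p ^ d.factorization p ≤ d := Nat.ordProj_le p hd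
  have h2 : 2 ^ d.factorization p ≤ p ^ d.factorization p := Nat.pow_le_pow_left hp.two_le _
  by_contra h
  push Not at h
  have h3 : 2 ^ (A + 1) ≤ 2 ^ d.factorization p := Nat.pow_le_pow_right (by norm_num) h
  omega

/-- **The sum over the original ranges equals the sum over the box** when `P` contains all primes
`≤ max(D_max, ⌈R⌉)`, `2^{A+1} > D_max`, and `Ψ((y+h_j)/d) = 0` for `d > D_max` (`R > 1`).
[cite: TaoTeravainen2021, §8 ("Note that the restrictions on `d₁,…,d_k` can be dropped thanks to the
support of the `Ψ_{d_j}`")] -/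
theorem sum_boxRanges_eq_sum_sixBox (χ : DirichletCharacter ℂ q) (φ : ℝ → ℝ) {ψ : ℝ → ℝ} (hψ : IsSmoothCutoff ψ)
    (X U₀ : ℝ) {R : ℝ} (hR : 1 < R) (h₁ h₂ : ℕ) (y : ℝ) {P : Finset ℕ} (hP : ∀ p ∈ P, p.Prime)
    {A Dmax : ℕ} (hPD : ∀ p : ℕ, p.Prime → p ≤ max Dmax ⌈R⌉₊ → p ∈ P) (hA : Dmax < 2 ^ (A + 1))
    (hΨ₁ : ∀ d : ℕ, Dmax < d → psiSharp φ ψ X U₀ ((y + h₁) / d) = 0)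
    (hΨ₂ : ∀ d : ℕ, Dmax < d → psiSharp φ ψ X U₀ ((y + h₂) / d) = 0) :
    ∑ n ∈ boxRanges R Dmax, sixSummandR χ φ ψ X U₀ R h₁ h₂ y n =
      ∑ n ∈ sixBox P A, sixSummandR χ φ ψ X U₀ R h₁ h₂ y n := by
  classical
  set F := sixSummandR χ φ ψ X U₀ R h₁ h₂ y with hF
  -- vanishing criteria
  have hzero_sieve : ∀ n : Slot → ℕ, ∀ j : Fin 2, ∀ i : Fin 3, i ≠ 0 → sieveWt ψ R (n (j, i)) = 0 → F n = 0 := by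
    intro n j i hi h0
    simp only [hF, sixSummandR, smoothCoeff, slotTriple]
    fin_cases j <;> fin_cases i <;> simp_all
  have hzero_d : ∀ n : Slot → ℕ, ∀ j : Fin 2, Dmax < n (j, 0) → F n = 0 := by
    intro n j hd
    simp only [hF, sixSummandR]
    have hprod : psiSharp φ ψ X U₀ ((y + h₁) / n (0, 0)) * psiSharp φ ψ X U₀ ((y + h₂) / n (1, 0)) = 0 := by
      fin_cases j
      · simp only [Fin.zero_eta, Fin.isValue] at hd
        rw [hΨ₁ _ hd, zero_mul]
      · simp only [Fin.mk_one, Fin.isValue] at hd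
        rw [hΨ₂ _ hd, mul_zero]
    rw [hprod, mul_zero]
  -- both sums equal the sum over the intersection
  have hleft : ∑ n ∈ boxRanges R Dmax, F n = ∑ n ∈ boxRanges R Dmax ∩ sixBox P A, F n := by
    symm
    refine sum_subset inter_subset_left fun n hn hni => ?_
    rw [mem_inter, not_and] at hni
    have hnb := hni hn
    -- `n` has a non-squarefree sieve coordinate (else it would lie in the box)
    unfold boxRanges at hn
    rw [Fintype.mem_piFinset] at hn
    have hpos : ∀ k, n k ≠ 0 := by
      intro k; have := hn k
      split_ifs at this with hk
      · rw [mem_Icc] at this; omega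
      · rw [mem_sieveRange] at this; omega
    have hle : ∀ k, n k ≤ max Dmax ⌈R⌉₊ := by
      intro k; have := hn k
      split_ifs at this with hk
      · rw [mem_Icc] at this; exact this.2.trans (le_max_left _ _)
      · unfold sieveRange at this; rw [mem_Ico] at this; exact (le_of_lt this.2).trans (le_max_right _ _)
    have hprimes : ∀ k, (n k).primeFactors ⊆ P := fun k p hp =>
      hPD p (Nat.prime_of_mem_primeFactors hp) ((Nat.le_of_mem_primeFactors hp).trans (hle k))
    by_contra hFn
    refine hnb (mem_sixBox_of hP hpos hprimes fun k p hp => ?_)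
    rw [mem_locRange_iff]
    by_cases hk : k.2 = 0
    · left
      refine ⟨hk, factorization_le_of_lt_two_pow (hpos k) ?_ (hP p hp)⟩
      have := hn k
      rw [if_pos hk, mem_Icc] at this
      omega
    · right
      refine ⟨hk, ?_⟩
      -- squarefree, else `μ = 0`
      by_contra hv
      push Not at hv
      refine hFn (hzero_sieve n k.1 k.2 hk ?_)
      have hnsq : ¬ Squarefree (n (k.1, k.2)) := by
        intro hsq
        have := hsq.natFactorization_le_one p
        exact absurd this (by simpa using hv)
      rw [sieveWt, ArithmeticFunction.moebius_eq_zero_of_not_squarefree hnsq, Int.cast_zero, zero_mul]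
  have hright : ∑ n ∈ sixBox P A, F n = ∑ n ∈ boxRanges R Dmax ∩ sixBox P A, F n := by
    symm
    refine sum_subset inter_subset_right fun n hn hni => ?_
    rw [mem_inter, not_and'] at hni
    have hnr := hni hn
    -- some coordinate is out of range
    obtain ⟨α, hα, rfl⟩ := (mem_sixBox_iff).mp hn
    have hpos : ∀ k, decodeBox P α k ≠ 0 := fun k => (decodeBox_pos hP α k).ne'
    unfold boxRanges at hnr
    rw [Fintype.mem_piFinset, not_forall] at hnr
    obtain ⟨k, hk⟩ := hnr
    by_cases hk0 : k.2 = 0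
    · rw [if_pos hk0, mem_Icc, not_and_or, not_le, not_le] at hk
      rcases hk with hk | hk
      · exact absurd hk (by have := hpos k; omega)
      · have : Dmax < decodeBox P α (k.1, 0) := by rw [← hk0]; exact hk
        exact hzero_d _ k.1 this
    · rw [if_neg hk0, mem_sieveRange, not_and_or, not_le, not_lt] at hk
      rcases hk with hk | hk
      · exact absurd hk (by have := hpos k; omega)
      · exact hzero_sieve _ k.1 k.2 hk0 (sieveWt_eq_zero_of_le hψ hR hk)
  rw [hleft, hright]

/-! ### The slot transforms and the kernel -/

/-- The slot exponent `s_k(τ)`: `-1/X + 2πiτ` in the `d`-slots, `(-1 + 2πiτ)/log R` in the sieve slots.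
[cite: TaoTeravainen2021, Lemma 8.2 (8.12)–(8.13)] -/
def slotExpo (X R : ℝ) (k : Slot) (τ : ℝ) : ℂ :=
  if k.2 = 0 then (-(X⁻¹ : ℝ) : ℂ) + 2 * π * τ * I else ((-1 : ℂ) + 2 * π * τ * I) / (Real.log R : ℂ)

/-- `n^s := exp(s log n)` for natural `n` (completely multiplicative on `n ≥ 1`). [folklore] -/
def npow (s : ℂ) (n : ℕ) : ℂ := Complex.exp (s * (Real.log n : ℂ))

/-- `1^s = 1`. [folklore] -/
@[simp] theorem npow_one (s : ℂ) : npow s 1 = 1 := by simp [npow]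

/-- `(mn)^s = m^s n^s` for `m, n ≥ 1`. [folklore] -/
theorem npow_mul {s : ℂ} {m n : ℕ} (hm : m ≠ 0) (hn : n ≠ 0) : npow s (m * n) = npow s m * npow s n := by
  unfold npow
  rw [← Complex.exp_add]
  congr 1
  push_cast
  rw [Real.log_mul (by exact_mod_cast hm) (by exact_mod_cast hn)]
  push_cast; ring

/-- `(p^a)^s = (p^s)^a`. [folklore] -/
theorem npow_pow (s : ℂ) (p a : ℕ) : npow s (p ^ a) = npow s p ^ a := by
  unfold npow
  rw [← Complex.exp_nat_mul]
  congr 1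
  push_cast
  rw [Real.log_pow]; push_cast; ring

/-- `‖n^s‖ = n^{Re s} ≤ 1` for `Re s ≤ 0`, `n ≥ 1`. [folklore] -/
theorem norm_npow_le_one {s : ℂ} (hs : s.re ≤ 0) {n : ℕ} (hn : 1 ≤ n) : ‖npow s n‖ ≤ 1 := by
  unfold npow
  rw [Complex.norm_exp, Complex.mul_re, Complex.ofReal_re, Complex.ofReal_im, mul_zero, sub_zero]
  exact Real.exp_le_one_iff.mpr (mul_nonpos_of_nonpos_of_nonneg hs (Real.log_nonneg (by exact_mod_cast hn)))

/-- The slot weights: `ĝ_{c_j}` in the `d`-slots (`c_j = log(y+h_j)`), `f` in the sieve slots.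
[cite: TaoTeravainen2021, Lemma 8.2] -/
def slotTransform (φ ψ : ℝ → ℝ) (X U₀ : ℝ) (h₁ h₂ : ℕ) (y : ℝ) (k : Slot) (τ : ℝ) : ℂ :=
  if k.2 = 0 then psiFourier φ ψ X U₀ (Real.log (y + (if k.1 = 0 then h₁ else h₂ : ℕ))) τ else sieveFourier ψ τ

/-- The arithmetic coefficient `χ(d₁)χ(d₂)μ(e₁)μ(e₁')μ(e₂)μ(e₂')` of a six-tuple. [cite: TaoTeravainen2021, §8 (8.9)] -/
def sixArith (χ : DirichletCharacter ℂ q) (n : Slot → ℕ) : ℂ :=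
  ∏ j : Fin 2, χ ((n (j, 0) : ℕ) : ZMod q) * (μ (n (j, 1)) : ℂ) * (μ (n (j, 2)) : ℂ)

/-- **The kernel** `K(τ) := ∑_{n ∈ box} crtDensity(n) · χχμμμμ · ∏_k n_k^{s_k(τ_k)}`.
[cite: TaoTeravainen2021, §8 (8.17) (the integrand `∏_p E_{p,t}`)] -/
def sixKernel (χ : DirichletCharacter ℂ q) (X R : ℝ) (h₁ h₂ : ℕ) (P : Finset ℕ) (A : ℕ) (τ : Slot → ℝ) : ℂ :=
  ∑ n ∈ sixBox P A, ((crtDensity h₁ h₂ (slotLcm n 0) (slotLcm n 1) : ℝ) : ℂ) * sixArith χ n *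
    ∏ k : Slot, npow (slotExpo X R k (τ k)) (n k)

/-- **The weight** `W(τ) := ∏_k w_k(τ_k)` (`= ĝ_{c₁}(τ₀₁) f f ĝ_{c₂}(τ₀₂) f f`).
[cite: TaoTeravainen2021, §8 (8.17)] -/
def sixWeight (φ ψ : ℝ → ℝ) (X U₀ : ℝ) (h₁ h₂ : ℕ) (y : ℝ) (τ : Slot → ℝ) : ℂ :=
  ∏ k : Slot, slotTransform φ ψ X U₀ h₁ h₂ y k (τ k)

/-! ### The Fourier representation of each summand -/

/-- The slot representation: for `n ≥ 1`,
in a `d`-slot `Ψ((y+h_j)/n) = ∫ n^{s(τ)} ĝ_{c_j}(τ) dτ` and in a sieve slot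
`ψ_{≤R}(n) = ∫ n^{s(τ)} f(τ) dτ`. [cite: TaoTeravainen2021, Lemma 8.2 (8.12)–(8.13)] -/
theorem slot_repr {φ ψ : ℝ → ℝ} (hφ : IsBump φ) (hψ : IsSmoothCutoff ψ) {X U₀ : ℝ} (hU₀ : 1 ≤ U₀)
    (hX : 2 * U₀ + 2 ≤ X) (hX3 : 3 * U₀ ≤ X) {R : ℝ} (hR : 1 < R) (h₁ h₂ : ℕ) {y : ℝ} (hy : 0 < y)
    (hc : ∀ j : Fin 2, Real.log (y + (if j = 0 then h₁ else h₂ : ℕ)) ≤ X + 1) (k : Slot) {n : ℕ} (hn : 1 ≤ n) :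
    (((if k.2 = 0 then psiSharp φ ψ X U₀ ((y + (if k.1 = 0 then h₁ else h₂ : ℕ)) / n) else cutoffLE ψ R n) : ℝ) : ℂ) =
      ∫ τ : ℝ, npow (slotExpo X R k τ) n * slotTransform φ ψ X U₀ h₁ h₂ y k τ := by
  have hn0 : (0 : ℝ) < n := by exact_mod_cast hn
  by_cases hk : k.2 = 0
  · -- `d`-slot
    simp only [hk, if_true, slotTransform, slotExpo]
    set c := Real.log (y + (if k.1 = 0 then h₁ else h₂ : ℕ)) with hcdef
    have hyh : 0 < y + (if k.1 = 0 then h₁ else h₂ : ℕ) := by positivity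
    have harg : (y + (if k.1 = 0 then h₁ else h₂ : ℕ)) / n = Real.exp (c - Real.log n) := by
      rw [Real.exp_sub, Real.exp_log hyh, Real.exp_log hn0]
    rw [harg, psiSharp_exp_sub_eq_integral hφ hψ hU₀ hX hX3 (hc k.1) (Real.log n), ← integral_const_mul]
    refine integral_congr_ae (ae_of_all _ fun τ => ?_)
    simp only [npow]
    rw [← mul_assoc, ← Complex.exp_add]
    congr 1
    push_cast; ring
  · -- sieve slot
    simp only [hk, if_false, slotTransform, slotExpo]
    unfold cutoffLE
    rw [cutoff_eq_integral hψ (Real.log n / Real.log R), ← integral_const_mul]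
    refine integral_congr_ae (ae_of_all _ fun τ => ?_)
    simp only [npow]
    rw [← mul_assoc, ← Complex.exp_add]
    congr 1
    have hlogR : (Real.log R : ℂ) ≠ 0 := by exact_mod_cast (Real.log_pos hR).ne'
    push_cast
    field_simp

/-! ### `G(y)` as a six-fold integral -/

/-- The slot value `V_k(m)`: `Ψ((y+h_j)/m)` in a `d`-slot, `ψ_{≤R}(m)` in a sieve slot. [folklore] -/
def slotValue (φ ψ : ℝ → ℝ) (X U₀ R : ℝ) (h₁ h₂ : ℕ) (y : ℝ) (k : Slot) (m : ℕ) : ℝ :=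
  if k.2 = 0 then psiSharp φ ψ X U₀ ((y + (if k.1 = 0 then h₁ else h₂ : ℕ)) / m) else cutoffLE ψ R m

/-- **The summand factorises over the slots**: for a quadratic `χ`,
`sixSummandR(n) = dens(n) · χχμμμμ · ∏_k V_k(n_k)` (as complex numbers). [cite: TaoTeravainen2021, §8 (8.9)] -/
theorem sixSummandR_eq_prod (χ : DirichletCharacter ℂ q) (hχ : χ.IsQuadratic) (φ ψ : ℝ → ℝ) (X U₀ R : ℝ)
    (h₁ h₂ : ℕ) (y : ℝ) (n : Slot → ℕ) :
    ((sixSummandR χ φ ψ X U₀ R h₁ h₂ y n : ℝ) : ℂ) =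
      ((crtDensity h₁ h₂ (slotLcm n 0) (slotLcm n 1) : ℝ) : ℂ) * sixArith χ n *
        ∏ k : Slot, ((slotValue φ ψ X U₀ R h₁ h₂ y k (n k) : ℝ) : ℂ) := by
  unfold sixSummandR sixArith smoothCoeff slotTriple sieveWt
  rw [Fin.prod_univ_two, Fintype.prod_prod_type, Fin.prod_univ_two, Fin.prod_univ_three, Fin.prod_univ_three]
  simp only [slotValue, Fin.isValue, if_true, show ((1 : Fin 3) = 0) = False by decide,
    show ((2 : Fin 3) = 0) = False by decide, if_false, show ((1 : Fin 2) = 0) = False by decide]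
  push_cast
  rw [realChar_coe χ hχ, realChar_coe χ hχ]
  ring

/-- Integrability of the slot integrands `τ ↦ m^{s_k(τ)} w_k(τ)` (`m ≥ 1`). [folklore] -/
theorem integrable_slot {φ ψ : ℝ → ℝ} (hφ : IsBump φ) (hψ : IsSmoothCutoff ψ) {X U₀ : ℝ} (hU₀ : 1 ≤ U₀)
    (hX : 2 * U₀ + 2 ≤ X) {R : ℝ} (hR : 1 < R) (h₁ h₂ : ℕ) {y : ℝ}
    (hc : ∀ j : Fin 2, Real.log (y + (if j = 0 then h₁ else h₂ : ℕ)) ≤ X + 1) (k : Slot) {m : ℕ} (hm : 1 ≤ m) :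
    Integrable fun τ : ℝ => npow (slotExpo X R k τ) m * slotTransform φ ψ X U₀ h₁ h₂ y k τ := by
  have hw : Integrable (slotTransform φ ψ X U₀ h₁ h₂ y k) := by
    unfold slotTransform
    by_cases hk : k.2 = 0
    · simp only [hk, if_true]
      exact (integrable_psiFourier hφ hψ hU₀ hX (hc k.1)).1
    · simp only [hk, if_false]
      exact integrable_sieveFourier hψ
  have hcont : Continuous fun τ : ℝ => npow (slotExpo X R k τ) m := by
    unfold npow slotExpo
    split_ifs <;> fun_prop
  refine hw.bdd_mul (c := 1) hcont.aestronglyMeasurable (ae_of_all _ fun τ => ?_)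
  refine norm_npow_le_one ?_ hm
  unfold slotExpo
  have hX0 : 0 < X := by linarith
  split_ifs
  · simp only [Complex.add_re, Complex.neg_re, Complex.ofReal_re, Complex.mul_re, Complex.re_ofNat,
      Complex.ofReal_im, Complex.im_ofNat, Complex.I_re, Complex.I_im, Complex.mul_im]
    have : 0 < X⁻¹ := by positivity
    nlinarith
  · have hlogR : 0 < Real.log R := Real.log_pos hR
    rw [Complex.div_ofReal_re]
    refine div_nonpos_of_nonpos_of_nonneg ?_ hlogR.le
    simp

/-- **`G(y)` over the box as a six-fold Fourier integral**:
`∑_{n ∈ box} sixSummandR(n) = ∫_{ℝ⁶} K(τ) W(τ) dτ` (`χ` quadratic, `U₀ ≥ 1`, `2U₀ + 2 ≤ X`, `3U₀ ≤ X`,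
`R > 1`, `y > 0`, `log(y + h_j) ≤ X + 1`). [cite: TaoTeravainen2021, §8 (8.17)] -/
theorem sum_sixBox_eq_integral (χ : DirichletCharacter ℂ q) (hχ : χ.IsQuadratic) {φ ψ : ℝ → ℝ}
    (hφ : IsBump φ) (hψ : IsSmoothCutoff ψ) {X U₀ : ℝ} (hU₀ : 1 ≤ U₀) (hX : 2 * U₀ + 2 ≤ X)
    (hX3 : 3 * U₀ ≤ X) {R : ℝ} (hR : 1 < R) (h₁ h₂ : ℕ) {y : ℝ} (hy : 0 < y)
    (hc : ∀ j : Fin 2, Real.log (y + (if j = 0 then h₁ else h₂ : ℕ)) ≤ X + 1) {P : Finset ℕ}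
    (hP : ∀ p ∈ P, p.Prime) (A : ℕ) :
    ((∑ n ∈ sixBox P A, sixSummandR χ φ ψ X U₀ R h₁ h₂ y n : ℝ) : ℂ) =
      ∫ τ : Slot → ℝ, sixKernel χ X R h₁ h₂ P A τ * sixWeight φ ψ X U₀ h₁ h₂ y τ := by
  have hpos : ∀ n ∈ sixBox P A, ∀ k, 1 ≤ n k := by
    intro n hn k
    obtain ⟨α, -, rfl⟩ := (mem_sixBox_iff).mp hn
    exact decodeBox_pos hP α k
  -- each summand as a six-fold integral
  have hterm : ∀ n ∈ sixBox P A, ((sixSummandR χ φ ψ X U₀ R h₁ h₂ y n : ℝ) : ℂ) =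
      ∫ τ : Slot → ℝ, ((crtDensity h₁ h₂ (slotLcm n 0) (slotLcm n 1) : ℝ) : ℂ) * sixArith χ n *
        ∏ k : Slot, (npow (slotExpo X R k (τ k)) (n k) * slotTransform φ ψ X U₀ h₁ h₂ y k (τ k)) := by
    intro n hn
    rw [sixSummandR_eq_prod χ hχ, integral_const_mul]
    congr 1
    have hslot : ∀ k : Slot, ((slotValue φ ψ X U₀ R h₁ h₂ y k (n k) : ℝ) : ℂ) =
        ∫ τ : ℝ, npow (slotExpo X R k τ) (n k) * slotTransform φ ψ X U₀ h₁ h₂ y k τ := fun k => by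
      unfold slotValue
      exact slot_repr hφ hψ hU₀ hX hX3 hR h₁ h₂ hy hc k (hpos n hn k)
    simp_rw [hslot]
    exact (integral_fintype_prod_volume_eq_prod (𝕜 := ℂ)
      (fun k τ => npow (slotExpo X R k τ) (n k) * slotTransform φ ψ X U₀ h₁ h₂ y k τ)).symm
  -- integrability
  have hint : ∀ n ∈ sixBox P A, Integrable (fun τ : Slot → ℝ =>
      ((crtDensity h₁ h₂ (slotLcm n 0) (slotLcm n 1) : ℝ) : ℂ) * sixArith χ n *
        ∏ k : Slot, (npow (slotExpo X R k (τ k)) (n k) * slotTransform φ ψ X U₀ h₁ h₂ y k (τ k))) := by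
    intro n hn
    refine Integrable.const_mul ?_ _
    have h : Integrable (fun τ : Slot → ℝ => ∏ k : Slot,
        (npow (slotExpo X R k (τ k)) (n k) * slotTransform φ ψ X U₀ h₁ h₂ y k (τ k)))
        (Measure.pi fun _ : Slot => (volume : Measure ℝ)) :=
      Integrable.fintype_prod (f := fun k τ => npow (slotExpo X R k τ) (n k) * slotTransform φ ψ X U₀ h₁ h₂ y k τ)
        fun k => integrable_slot hφ hψ hU₀ hX hR h₁ h₂ hc k (hpos n hn k)
    rwa [← volume_pi] at h
  push_cast
  rw [sum_congr rfl hterm, ← integral_finsetSum _ hint]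
  refine integral_congr_ae (ae_of_all _ fun τ => ?_)
  beta_reduce
  unfold sixKernel sixWeight
  rw [sum_mul]
  refine sum_congr rfl fun n _ => ?_
  rw [prod_mul_distrib]
  ring

/-- **The pointwise sum as a six-fold Fourier integral of the kernel**: under the hypotheses of
`sum_boxRanges_eq_sum_sixBox` and `sum_sixBox_eq_integral`,
`G(y) = ∫_{ℝ⁶} K(τ) W(τ) dτ`. [cite: TaoTeravainen2021, §8 (8.17)] -/
theorem smoothPointwise_eq_integral (χ : DirichletCharacter ℂ q) (hχ : χ.IsQuadratic) {φ ψ : ℝ → ℝ}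
    (hφ : IsBump φ) (hψ : IsSmoothCutoff ψ) {X U₀ : ℝ} (hU₀ : 1 ≤ U₀) (hX : 2 * U₀ + 2 ≤ X)
    (hX3 : 3 * U₀ ≤ X) {R : ℝ} (hR : 1 < R) (h₁ h₂ : ℕ) {y : ℝ} (hy : 0 < y)
    (hc : ∀ j : Fin 2, Real.log (y + (if j = 0 then h₁ else h₂ : ℕ)) ≤ X + 1) {P : Finset ℕ}
    (hP : ∀ p ∈ P, p.Prime) {A Dmax : ℕ} (hPD : ∀ p : ℕ, p.Prime → p ≤ max Dmax ⌈R⌉₊ → p ∈ P)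
    (hA : Dmax < 2 ^ (A + 1)) (hΨ₁ : ∀ d : ℕ, Dmax < d → psiSharp φ ψ X U₀ ((y + h₁) / d) = 0)
    (hΨ₂ : ∀ d : ℕ, Dmax < d → psiSharp φ ψ X U₀ ((y + h₂) / d) = 0) :
    ((smoothPointwise χ φ ψ X U₀ R h₁ h₂ Dmax y : ℝ) : ℂ) =
      ∫ τ : Slot → ℝ, sixKernel χ X R h₁ h₂ P A τ * sixWeight φ ψ X U₀ h₁ h₂ y τ := by
  rw [smoothPointwise_eq_sum_boxRanges, sum_boxRanges_eq_sum_sixBox χ φ hψ X U₀ hR h₁ h₂ y hP hPD hA hΨ₁ hΨ₂,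
    sum_sixBox_eq_integral χ hχ hφ hψ hU₀ hX hX3 hR h₁ h₂ hy hc hP A]


/-! ### The Euler product `K(τ) = ∏_{p ∈ P} E_p(τ)` -/

/-- `μ(p^a)` as a complex number: `1, -1, 0` for `a = 0, 1, ≥ 2`. [folklore] -/
def moebiusPow (a : ℕ) : ℂ := if a = 0 then 1 else if a = 1 then -1 else 0

/-- The local arithmetic coefficient `∏_j χ(p)^{λ(j,0)} μ(p^{λ(j,1)}) μ(p^{λ(j,2)})`.
[cite: TaoTeravainen2021, §8 (8.19)] -/
def locArith (χ : DirichletCharacter ℂ q) (p : ℕ) (lam : Slot → ℕ) : ℂ :=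
  ∏ j : Fin 2, χ ((p : ℕ) : ZMod q) ^ lam (j, 0) * moebiusPow (lam (j, 1)) * moebiusPow (lam (j, 2))

/-- **The local factor** `E_p(τ) := ∑_{λ ∈ locBox} localDens_p(λ) · locArith_p(λ) · ∏_k (p^{s_k(τ_k)})^{λ_k}`
(the source's `E_{p,t}` (8.18) at `k = 2`, with the `d`-exponents truncated at `A`).
[cite: TaoTeravainen2021, §8 (8.18)–(8.19)] -/
def sixLocalFactor (χ : DirichletCharacter ℂ q) (X R : ℝ) (h₁ h₂ p A : ℕ) (τ : Slot → ℝ) : ℂ :=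
  ∑ lam ∈ locBox A, ((localDens p ((shiftDiff h₁ h₂).factorization p) lam : ℝ) : ℂ) * locArith χ p lam *
    ∏ k : Slot, npow (slotExpo X R k (τ k)) p ^ lam k

/-- `npow` of a product of nonzero naturals. [folklore] -/
theorem npow_finset_prod {ι : Type*} (s : ℂ) (S : Finset ι) (g : ι → ℕ) (hg : ∀ i ∈ S, g i ≠ 0) :
    npow s (∏ i ∈ S, g i) = ∏ i ∈ S, npow s (g i) := by
  classical
  induction S using Finset.induction_on with
  | empty => simp
  | insert a S ha ih =>
    rw [prod_insert ha, prod_insert ha, npow_mul (hg a (mem_insert_self _ _))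
      (prod_ne_zero_iff.mpr fun i hi => hg i (mem_insert_of_mem hi)), ih fun i hi => hg i (mem_insert_of_mem hi)]

/-- **The Euler product of the kernel** ((2.11) for the six-slot box, `h₁ ≠ h₂`):
`K(τ) = ∏_{p ∈ P} E_p(τ)`. [cite: TaoTeravainen2021, §8 (8.17)–(8.18)] -/
theorem sixKernel_eq_prod (χ : DirichletCharacter ℂ q) (X R : ℝ) {h₁ h₂ : ℕ} (hne : h₁ ≠ h₂)
    {P : Finset ℕ} (hP : ∀ p ∈ P, p.Prime) (A : ℕ) (τ : Slot → ℝ) :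
    sixKernel χ X R h₁ h₂ P A τ = ∏ p : P, sixLocalFactor χ X R h₁ h₂ p A τ := by
  unfold sixKernel sixLocalFactor
  refine sum_sixBox_eq_prod hP A _ _ fun α _ => ?_
  -- the three factorizations
  have hdens : ((crtDensity h₁ h₂ (slotLcm (decodeBox P α) 0) (slotLcm (decodeBox P α) 1) : ℝ) : ℂ) =
      ∏ p : P, ((localDens p ((shiftDiff h₁ h₂).factorization p) (α p) : ℝ) : ℂ) := by
    rw [crtDensity_decodeBox hP hne]; push_cast; rfl
  have hmu : ∀ k, (μ (decodeBox P α k) : ℂ) = ∏ p : P, moebiusPow (α p k) := by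
    intro k
    have h := moebius_decodeBox hP α k
    have h' : ((μ (decodeBox P α k) : ℤ) : ℂ) = ((∏ p : P, (μ ((p : ℕ) ^ α p k) : ℤ) : ℤ) : ℂ) := by rw [h]
    rw [h', Int.cast_prod]
    refine prod_congr rfl fun p _ => ?_
    rw [moebius_prime_pow (hP p p.2)]
    unfold moebiusPow
    split_ifs <;> simp
  have hchi : ∀ k, χ ((decodeBox P α k : ℕ) : ZMod q) = ∏ p : P, χ ((p : ℕ) : ZMod q) ^ α p k := by
    intro k
    rw [cast_decodeBox, map_prod]
    simp_rw [map_pow]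
  have harith : sixArith χ (decodeBox P α) = ∏ p : P, locArith χ p (α p) := by
    unfold sixArith locArith
    simp_rw [hchi, hmu, ← prod_mul_distrib]
    rw [prod_comm]
  have hnpow : ∏ k : Slot, npow (slotExpo X R k (τ k)) (decodeBox P α k) =
      ∏ p : P, ∏ k : Slot, npow (slotExpo X R k (τ k)) p ^ α p k := by
    rw [prod_comm]
    refine prod_congr rfl fun k _ => ?_
    unfold decodeBox
    rw [npow_finset_prod _ _ _ fun (p : P) _ => (pow_pos (hP p p.2).pos _).ne']
    exact prod_congr rfl fun p _ => npow_pow _ _ _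
  rw [hdens, harith, hnpow, ← prod_mul_distrib, ← prod_mul_distrib]


end TaoTeravainen

end Literature.Barriers.Parity
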